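import Summits.Ventures.PercRepro.StarGadgetPurePairG

/-!
# `G` at the brute-force twin points: the Lean polynomial evaluates to the (★)-slack counted on the actual gadget graph

Each value below is the (★)-slack `Δ = #Kc + #Lc + #KLc₂ − #KL` over the bot configurations of the REAL gadget
(marks `a b c`, `x ~ c`, the hubs, the pure pairs `u ~ v`, `u, v ~ x`, `u, v ~ c`), counted by an independent brute-force
enumeration of every open edge set written from the definition of (★) alone (lean-drafts/p1/checks-g10/twin/bfstar.c, bfsym.c;
0 mismatches against `G` on 388 gadgets with ≤ 22 edges by plain enumeration and on 534 gadgets with up to 29 edges by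
orbit representatives).  `G_ray` (`G 0 0 0 0 n = 0`) is the tight ray.  These are kernel-checked evaluations of `G`, tying the
arithmetic theorem `G_nonneg` to the gadget it is about.
-/

namespace PercRepro.StarGadget

/-- `G 1 0 0 0 0 = 1`: the single double hub (the tight case F(1,0,0,0) = 1 of the star-gadget theorem) — brute-force (★)-slack 1. -/
theorem G_at_10000 : G 1 0 0 0 0 = 1 := by
  unfold G
  norm_num

/-- `G 0 0 0 1 0 = 5`: one {a,b,c}-hub — brute-force (★)-slack 5. -/
theorem G_at_00010 : G 0 0 0 1 0 = 5 := by
  unfold G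
  norm_num

/-- `G 1 1 0 0 1 = 736`: one {a,b}-hub, one {a,c}-hub, one pure pair (12 edges) — brute-force (★)-slack 736. -/
theorem G_at_11001 : G 1 1 0 0 1 = 736 := by
  unfold G
  norm_num

/-- `G 2 2 0 0 1 = 21376`: two {a,b}-hubs, two {a,c}-hubs, one pure pair (18 edges) — brute-force (★)-slack 21376. -/
theorem G_at_22001 : G 2 2 0 0 1 = 21376 := by
  unfold G
  norm_num

/-- `G 2 1 0 0 2 = 96768`: two {a,b}-hubs, one {a,c}-hub, two pure pairs (20 edges) — brute-force (★)-slack 96768. -/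
theorem G_at_21002 : G 2 1 0 0 2 = 96768 := by
  unfold G
  norm_num

/-- `G 3 0 0 0 3 = 1732608`: three {a,b}-hubs, three pure pairs (25 edges) — brute-force (★)-slack 1732608. -/
theorem G_at_30003 : G 3 0 0 0 3 = 1732608 := by
  unfold G
  norm_num

/-- `G 0 0 0 2 3 = 1658880`: two {a,b,c}-hubs, three pure pairs (24 edges) — brute-force (★)-slack 1658880. -/
theorem G_at_00023 : G 0 0 0 2 3 = 1658880 := by
  unfold G
  norm_num

/-- `G 1 0 0 0 4 = 2031616`: one {a,b}-hub, four pure pairs (24 edges) — brute-force (★)-slack 2031616. -/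
theorem G_at_10004 : G 1 0 0 0 4 = 2031616 := by
  unfold G
  norm_num

end PercRepro.StarGadget
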